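import Summits.BirchSwinnertonDyer.BirchSwinnertonDyer.Theorems.QuadraticBranchSignedControlPlusEtaLowerInclusionTamagawaRoadLevel
import Summits.BirchSwinnertonDyer.Rank1Residual.X11b.KummerLocalIndex
import Literature.NumberTheory.EllipticCurves.MordellWeilTheoremProofs
import Literature.NumberTheory.EllipticCurves.SelmerFiniteProofs
import Mathlib.LinearAlgebra.FreeModule.ModN
import HarnessLib

/-!
# Route `QuadraticBranchSignedControl` (rung K8, cell `bsd-potss`), crux `PlusEtaLowerInclusion`
# (item stmt-BirchSwinnertonDyer-19601): THE TAMAGAWA ROAD WITH THE MORDELL–WEIL CLASSES, part 1 —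
# the Poitou–Tate brick with a subgroup of `T`-locally trivial Selmer classes,
# `∏_{w ∈ T} [𝓖_w : 𝓚_w] · #B ∣ #H¹_𝓖`, and the Kummer image of the rational points

WHAT. The Tamagawa road of this seat's g4 (`…TamagawaRoadCount` p513046, `…Duality` p514033,
`…TamagawaRoad` p515151, `…TamagawaRoadLevel` p515783) gives, at a tower-onto pair of rank `r`,
`v_alg ≥ ∑_T ord_p c_ℓ(W) − k·r`: the rank-free brick `∏_T [𝓖_w : 𝓚_w] ∣ #H¹_𝓖` knows nothing about
the Mordell–Weil classes, and `p^{k·r}` is lost to the divisible part of `Sel⁺(W/ℚ_∞)^Γ`. This file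
(any number field `K`, any elliptic `E/K`, level `p^m`) puts them in:

* §1 `pow_finrank_le_natCard_range` (groups): `n^{rank_ℤ A} ≤ #ψ(A)` when `ker ψ ⊆ nA`, `A` f.g.
* §2 **`prod_relIndex_mul_natCard_dvd_natCard_selmerGroup`**: for a Selmer structure `𝓖 ⊇ 𝓚` enlarging
  the Kummer structure at `T` and equal to it elsewhere, and ANY `B ≤ H¹_𝓚 = Sel^{(p^m)}(E/K)` whose
  classes localise to `0` at every `w ∈ T`: **`∏_T [𝓖_w : 𝓚_w] · #B ∣ #H¹_𝓖`**, GRANTED `hPT`. Howard's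
  product formula `[H¹_𝓖 : H¹_𝓚]·[H¹_{𝓚^*} : H¹_{𝓖^*}] = ∏_T [𝓖_w : 𝓚_w]` (x1b file 58) and the Weil
  transport (`H¹_{𝓚^*} = w_*H¹_𝓚`, X5's residual self-duality of `𝓚`): `w_*` is injective and carries
  `B` INTO `H¹_{𝓖^*}` (at `w ∈ T` the class `0` lies in every condition; off `T` the transported dual
  of `𝓖` is that of `𝓚`, i.e. `𝓚`), so `∏ · #B ∣ ∏ · #H¹_{𝓖^*} = [H¹_𝓖 : H¹_𝓚] · #H¹_{𝓚^*} ∣ #H¹_𝓖`.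
  `B = 0` is g4's rank-free brick; `B = H¹_𝓚` is ctrl's `relIndex_kummer_eq_prod_of_localization_eq_zero`.
* §3 the Kummer image `κ_n(E(K))`, `n = p^m`: it lies in `H¹_𝓚`
  (`range_kummerMapTorsion_le_selmerGroup_kummerSelmerStructure`), has `#κ_n(E(K)) ≥ p^{m·rank E(K)}`
  (`pow_mul_mordellWeilRank_le_natCard_range_kummerMapTorsion`: Mordell–Weil + `ker κ_n = nE(K)` + §1),
  and `loc_w κ_n(P) = 0` as soon as `P` is `n`-divisible in `E(K_w)`
  (`localization_kummerMapTorsion_eq_zero_of_divisible`: tree `res_kummerMapTorsion_eq_localKummerMap` +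
  `ker_localKummerMap`).
Parts 2/3 (`…TamagawaRoadMordellWeilCount`, `…TamagawaRoadMordellWeil`) feed `B = κ_{p^m}(W(ℚ))` into
the twist-level count and the `η`-side chain: `p^v ∣ #(X_η/TX_η)_tors` for EVERY `v ≤ ∑_T ord_p c_ℓ(W)`
(no `−k·r`) when `W(ℚ)` is `p^m`-divisible in `W(ℚ_ℓ)` at every `ℓ ∈ T`.

HONEST FRAMING (cell `bsd-potss`, run/shared/lean/pub/bsd-potss/; FULL-BSD rank ≤ 1 programme, HUMAN
RULING D-0036/D-0074): TOOL THEOREMS ONLY — no definition, no named Literature fact minted, no `sorry`,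
axioms standard; the crux 19601 (class-wide Eisenstein inclusion at `η`) is OPEN and NOT closed; no row
is certified by this file; nothing is booked; `BSD(W, p)` is claimed for no pair.
`--supports stmt-BirchSwinnertonDyer-19601` (seat `bsd-potss-k8eta-c1`, gen 5).

References: [Howard2004HeegnerKolyvagin] Thm. 2.1.11; [MilneADT2006] I Thm. 2.8, Cor. 3.4, Thm. 4.10;
[SilvermanAEC2009] VIII.§1–2, X.§4 (**), Prop. III.8.1; [GreenbergLNM1716] §4 (pp. 98–103).
-/


set_option autoImplicit false
set_option linter.dupNamespace false

noncomputable section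

open scoped Classical AddSubgroup

open CategoryTheory Field Function NumberField IsDedekindDomain WeierstrassCurve CongruenceSubgroup
open Literature.NumberTheory.EllipticCurves
open Literature.NumberTheory.EllipticCurves.ModularForms
open Literature.NumberTheory.GaloisRepresentations
open Literature.NumberTheory.GaloisRepresentations.DiscreteGaloisModule (SelmerStructure)
open Literature.NumberTheory.GaloisCohomology
open Literature.NumberTheory.EllipticCurves.IwasawaDual
open Literature.NumberTheory.EllipticCurves.IwasawaAlgebra
open Summit.BirchSwinnertonDyer.Rank1Residual
open Summit.BirchSwinnertonDyer.Rank1Residual.X5.SelfDualCount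
open Summit.BirchSwinnertonDyer.Rank1Residual.GaloisImage.CoreRankZero (selmerGroup_mono)
open Summit.BirchSwinnertonDyer.Rank1Residual.Additive.PoitouTateCountingProduct
open Summit.BirchSwinnertonDyer.Rank1Residual.X11b.Levels
open Summit.BirchSwinnertonDyer.Rank1Residual.X11b
open Summit.BirchSwinnertonDyer.Rank1Residual.Additive
open Summit.BirchSwinnertonDyer.Rank1Residual.Additive.LevelBridge
open Summit.BirchSwinnertonDyer.Rank1Residual.Additive.RankZeroCount
open scoped ContRepresentation

namespace Summit.BirchSwinnertonDyer.BirchSwinnertonDyer.Theorems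

namespace TamagawaRoad

/-! ## §1 Mordell–Weil counting: `n^{rank_ℤ A} ≤ #ψ(A)` when `ker ψ ⊆ nA` -/

section Counting

variable {A U : Type*} [AddCommGroup A] [AddCommGroup U]

/-- **`n ^ rank_ℤ A ≤ #ψ(A)`** for a finitely generated abelian group `A` and an additive map `ψ`
whose kernel consists of `n`-th multiples (`ψ a = 0 → a ∈ nA`), `ψ(A)` finite: `A ↠ (A/A_tors)/n ≅
(ℤ/n)^{rank}` kills `ker ψ ⊆ nA`, so it factors through `A/ker ψ ≅ ψ(A)`. (The algebra of
`#E(K)/nE(K) ≥ n^{rank}`, Silverman AEC VIII.§1; the tree's `pow_finrank_add_two_le_natCard_range`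
without its torsion witnesses.) [cite: SilvermanAEC2009, VIII.§1 (weak Mordell–Weil count)] -/
theorem pow_finrank_le_natCard_range [Module.Finite ℤ A] (ψ : A →+ U) {n : ℕ} (hn : n ≠ 0)
    (hker : ∀ a, ψ a = 0 → ∃ b, a = (n : ℤ) • b) [Finite ψ.range] :
    n ^ Module.finrank ℤ A ≤ Nat.card ψ.range := by
  haveI : NeZero n := ⟨hn⟩
  set T := AddCommGroup.torsion A with hT
  let π : A →ₗ[ℤ] A ⧸ T := (QuotientAddGroup.mk' T).toIntLinearMap
  have hπ : Function.Surjective π := QuotientAddGroup.mk'_surjective T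
  haveI : Module.Finite ℤ (A ⧸ T) := Module.Finite.of_surjective π hπ
  haveI : NoZeroSMulDivisors ℤ (A ⧸ T) := inferInstance
  haveI : Module.Free ℤ (A ⧸ T) := Module.free_of_finite_type_torsion_free'
  have hrank : Module.finrank ℤ (A ⧸ T) = Module.finrank ℤ A := by
    have hker' : LinearMap.ker π ≤ Submodule.torsion ℤ A := by
      intro x hx
      have hx' : x ∈ T := (QuotientAddGroup.eq_zero_iff x).mp (LinearMap.mem_ker.mp hx)
      rwa [hT, ← Submodule.torsion_int] at hx'
    rw [← (π.quotKerEquivOfSurjective hπ).finrank_eq]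
    exact finrank_quotient_eq_of_le_torsion hker'
  -- `g : A → (A/T)/n`, surjective, kills `ker ψ`
  let g : A →+ ModN (A ⧸ T) n := (ModN.mkQ n).comp (QuotientAddGroup.mk' T)
  have hg : Function.Surjective g :=
    (Submodule.mkQ_surjective _).comp (QuotientAddGroup.mk'_surjective T)
  have hle : ψ.ker ≤ g.ker := by
    intro a ha
    obtain ⟨b, rfl⟩ := hker a ha
    rw [AddMonoidHom.mem_ker]
    change ModN.mkQ n (QuotientAddGroup.mk' T ((n : ℤ) • b)) = 0
    rw [map_zsmul]
    exact (Submodule.Quotient.mk_eq_zero _).mpr ⟨QuotientAddGroup.mk' T b, rfl⟩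
  let Φ : A ⧸ ψ.ker →+ ModN (A ⧸ T) n := QuotientAddGroup.lift _ g hle
  have hΦ : Function.Surjective Φ := by
    intro y
    obtain ⟨a, rfl⟩ := hg y
    exact ⟨QuotientAddGroup.mk a, QuotientAddGroup.lift_mk _ hle a⟩
  -- `A / ker ψ ≅ ψ(A)` is finite, and surjects onto a group of order `n ^ rank`
  let e : A ⧸ ψ.ker ≃+ ψ.range := QuotientAddGroup.quotientKerEquivRange ψ
  haveI : Finite (A ⧸ ψ.ker) := Finite.of_equiv _ e.toEquiv.symm
  rw [← Nat.card_congr e.toEquiv, ← hrank, ← ModN.natCard_eq (A ⧸ T) n]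
  exact Nat.card_le_card_of_surjective Φ hΦ

end Counting

/-! ## §2 The brick with a subgroup of `T`-locally trivial Selmer classes:
`∏_{w ∈ T} [𝓖_w : 𝓚_w] · #B ∣ #H¹_𝓖` -/

section Brick

variable {K : Type} [Field K] [NumberField K] (W : WeierstrassCurve K) [W.IsElliptic]
  (p : ℕ) [hp : Fact p.Prime] (m : ℕ)

/-- **`∏_{w ∈ T} [𝓖_w : 𝓚_w] · #B ∣ #H¹_𝓖(K, E[p^m])`** for a Selmer structure `𝓖` on `E[p^m]` (`m ≥ 1`)
with `𝓖_w ⊇ 𝓚_w` at `w ∈ T` and `𝓖_v = 𝓚_v` elsewhere (`𝓚` the Kummer structure), and ANY subgroup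
`B ≤ H¹_𝓚 = Sel^{(p^m)}(E/K)` of classes that LOCALISE TO ZERO at every `w ∈ T`, GRANTED
`poitouTate_selmerStructure_duality_real K` (`hPT`). Howard's product `[H¹_𝓖 : H¹_𝓚]·[H¹_{𝓚^*} : H¹_{𝓖^*}]
= ∏_T [𝓖_w : 𝓚_w]`; the Weil transport `w_*` carries `B` injectively INTO `H¹_{𝓖^*}` (off `T` the
transported dual of `𝓖` is that of `𝓚`, i.e. `𝓚`; at `w ∈ T` the class `0` lies in every condition),
and `H¹_{𝓚^*} = w_*H¹_𝓚`; so `∏ · #B ∣ ∏ · #H¹_{𝓖^*} = [H¹_𝓖 : H¹_𝓚] · #H¹_{𝓚^*} ∣ [H¹_𝓖 : H¹_𝓚] · #H¹_𝓚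
= #H¹_𝓖`. With `B = 0` this is the rank-free brick `prod_relIndex_dvd_natCard_selmerGroup` (p513046); with
`B = H¹_𝓚` (every Kummer class `T`-locally trivial) it recovers ctrl's `[H¹_𝓖 : H¹_𝓚] = ∏` (p46xxxx).
[cite: Howard2004HeegnerKolyvagin, Thm. 2.1.11 (arXiv:1202.6340 p. 6)]
[cite: MilneADT2006, I Thm. 4.10, Cor. 3.4, Thm. 2.8] [cite: GreenbergLNM1716, §4 (pp. 98–103)] -/
theorem prod_relIndex_mul_natCard_dvd_natCard_selmerGroup (hm : 1 ≤ m)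
    (hPT : poitouTate_selmerStructure_duality_real K)
    (T : Finset (HeightOneSpectrum (𝓞 K)))
    (𝓖 : SelmerStructure (W.torsionGaloisModule ((p ^ m : ℕ) : ℤ)))
    (h𝓖T : ∀ w ∈ T, W.kummerSelmerStructure ((p ^ m : ℕ) : ℤ) (Sum.inr w) ≤ 𝓖 (Sum.inr w))
    (h𝓖off : ∀ v : Place K, (∀ w ∈ T, v ≠ Sum.inr w) →
      𝓖 v = W.kummerSelmerStructure ((p ^ m : ℕ) : ℤ) v)
    (B : AddSubgroup (galoisCohomology (W.torsionGaloisModule ((p ^ m : ℕ) : ℤ)) 1))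
    (hB : B ≤ (W.kummerSelmerStructure ((p ^ m : ℕ) : ℤ) :
        SelmerStructure (W.torsionGaloisModule ((p ^ m : ℕ) : ℤ))).selmerGroup)
    (hB0 : ∀ c ∈ B, ∀ w ∈ T,
      galoisCohomology.localization (W.torsionGaloisModule ((p ^ m : ℕ) : ℤ)) (Sum.inr w) 1 c = 0) :
    (∏ w ∈ T, (W.kummerSelmerStructure ((p ^ m : ℕ) : ℤ) (Sum.inr w)).relIndex (𝓖 (Sum.inr w))) *
        Nat.card B ∣
      Nat.card 𝓖.selmerGroup := by
  haveI : NeZero (p ^ m) := ⟨pow_ne_zero m hp.out.ne_zero⟩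
  have hpm : IsPrimePow (p ^ m) := (isPrimePow_nat_iff (p ^ m)).mpr ⟨p, m, hp.out, hm, rfl⟩
  haveI := finite_geomTorsion_of_neZero W (p ^ m)
  set 𝓚 : SelmerStructure (W.torsionGaloisModule ((p ^ m : ℕ) : ℤ)) :=
    W.kummerSelmerStructure ((p ^ m : ℕ) : ℤ) with h𝓚def
  -- the Poitou–Tate family from `hPT`, Tate's local Euler characteristic (a tree THEOREM), a Weil pairing
  obtain ⟨inv, hperf, hvan, -, hcomp, hreal⟩ := exists_localInvariants_injective_inl_of_real hPT (p ^ m)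
  have hEP : ∀ v : HeightOneSpectrum (𝓞 K), localEulerPoincareCharacteristic (v.adicCompletion K) :=
    fun v ↦ by
      haveI : CharZero (v.adicCompletion K) := charZero_adicCompletion v
      exact localEulerPoincareCharacteristic_holds (v.adicCompletion K)
  obtain ⟨e, hμ, hadd₁, hadd₂, halt, hnondeg, hgal⟩ := exists_weilPairing_holds W (p ^ m)
    (hp.out.two_le.trans (Nat.le_self_pow (by omega) p)) (Nat.cast_ne_zero.mpr (NeZero.ne (p ^ m)))
  -- the exceptional set `S ⊇ T ∪ ∞ ∪ {v ∣ p} ∪ bad`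
  obtain ⟨S, hTS, hinf, hpS, hbad⟩ :=
    X11b.KummerPT.exists_exceptional_finset W p (T.image (fun w ↦ (Sum.inr w : Place K)))
  have hT : ∀ w ∈ T, (Sum.inr w : Place K) ∈ S := fun w hw ↦ hTS (Finset.mem_image_of_mem _ hw)
  have hS : ∀ v : HeightOneSpectrum (𝓞 K), (Sum.inr v : Place K) ∉ S →
      (((p ^ m : ℕ) : ℕ) : 𝓞 K) ∉ v.asIdeal ∧
        GaloisRep.IsUnramifiedAt v (W.torsionGaloisModule ((p ^ m : ℕ) : ℤ)) := fun v hv ↦ by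
    have hpv : ((p : ℕ) : 𝓞 K) ∉ v.asIdeal := fun h ↦ hv (hpS v h)
    have hgood : W.HasGoodReductionAt v := by_contra fun h ↦ hv (hbad v h)
    have hpkv : ((p ^ m : ℕ) : 𝓞 K) ∉ v.asIdeal := by
      rw [Nat.cast_pow]
      exact fun h ↦ hpv (v.isPrime.mem_of_pow_mem m h)
    exact ⟨hpkv, X11b.AcSelmer.isUnramifiedAt_torsionGaloisModule W hgood
      (by rw [Int.cast_natCast]; exact hpkv)⟩
  have h𝓚 : SelmerStructure.IsUnramifiedOutside 𝓚 S :=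
    X11b.KummerDuality.kummerSelmerStructure_isUnramifiedOutside W p m S hinf hpS hbad
  -- `𝓚 ≤ 𝓖`, `𝓖` unramified outside `S`, they agree off `T`
  have hmemT : ∀ v : Place K, (¬ ∃ w ∈ T, v = Sum.inr w) → ∀ w ∈ T, v ≠ Sum.inr w :=
    fun v hv w hw h ↦ hv ⟨w, hw, h⟩
  have hle : 𝓚 ≤ 𝓖 := fun v ↦ by
    by_cases hv : ∃ w ∈ T, v = Sum.inr w
    · obtain ⟨w, hw, rfl⟩ := hv
      exact h𝓖T w hw
    · rw [h𝓖off v (hmemT v hv)]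
  have hdiff : ∀ v : Place K, (∀ w ∈ T, v ≠ Sum.inr w) → 𝓚 v = 𝓖 v := fun v hv ↦ (h𝓖off v hv).symm
  have h𝓖S : 𝓖.IsUnramifiedOutside S := by
    refine ⟨h𝓚.1, fun v hv ↦ ?_⟩
    rw [h𝓖off (Sum.inr v) (fun w hw h ↦ hv (h ▸ hT w hw))]
    exact h𝓚.2 v hv
  have hM : ∀ P : geomTorsion W ((p ^ m : ℕ) : ℤ), (p ^ m) • P = 0 := fun P ↦ AddSubgroup.torsionBy.nsmul P
  -- the product form of Howard's Thm. 2.1.11: `a · b = ∏`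
  have hprod := relIndex_selmerGroup_mul_relIndex_dual_eq_prod hperf hvan hcomp hM hS T hT hle h𝓖S hdiff
  -- residual self-duality of `𝓚` and the Weil transport: `#H¹_{𝓚^*} ∣ #H¹_𝓚`
  set wD := weilDualIntertwining W (p ^ m) e hμ hadd₁ hadd₂ hgal with hwD
  have hsd : inv.dualTransported 𝓚 wD = 𝓚 :=
    funext fun v ↦ dualTransported_kummerSelmerStructure_eq W (p ^ m) e hμ hadd₁ hadd₂ hgal halt hnondeg
      inv hpm hperf hEP hreal v
  have hdualcard : Nat.card (inv.dualSelmerStructure (W.torsionGaloisModule ((p ^ m : ℕ) : ℤ)) 𝓚).selmerGroup ∣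
      Nat.card 𝓚.selmerGroup := by
    rw [dualSelmerGroup_eq_map_selmerGroup_dualTransported W (p ^ m) e hμ hadd₁ hadd₂ hgal hnondeg inv 𝓚,
      hsd]
    exact AddSubgroup.card_map_dvd _ _
  -- the Weil transport carries `B` into `H¹_{𝓖^*}`
  set D𝓖 := (inv.dualSelmerStructure (W.torsionGaloisModule ((p ^ m : ℕ) : ℤ)) 𝓖).selmerGroup with hD𝓖
  set D𝓚 := (inv.dualSelmerStructure (W.torsionGaloisModule ((p ^ m : ℕ) : ℤ)) 𝓚).selmerGroup with hD𝓚
  have hBmap : B.map (galoisCohomology.map wD 1) ≤ D𝓖 := by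
    rintro _ ⟨x, hx, rfl⟩
    rw [hD𝓖, dualSelmerGroup_eq_map_selmerGroup_dualTransported W (p ^ m) e hμ hadd₁ hadd₂ hgal hnondeg inv 𝓖]
    refine ⟨x, ?_, rfl⟩
    have hx' := (SelmerStructure.mem_selmerGroup_iff _ _).mp (hB hx)
    rw [SetLike.mem_coe, SelmerStructure.mem_selmerGroup_iff]
    intro v
    by_cases hv : ∃ w ∈ T, v = Sum.inr w
    · obtain ⟨w, hw, rfl⟩ := hv
      rw [hB0 x hx w hw]
      exact zero_mem _
    · have heq : inv.dualTransported 𝓖 wD v = inv.dualTransported 𝓚 wD v := by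
        ext z
        rw [LocalInvariants.mem_dualTransported_iff, LocalInvariants.mem_dualTransported_iff,
          LocalInvariants.dualSelmerStructure_apply, LocalInvariants.dualSelmerStructure_apply,
          h𝓖off v (hmemT v hv)]
      rw [heq, hsd]
      exact hx' v
  have hDle : D𝓖 ≤ D𝓚 := selmerGroup_mono (inv.dualSelmerStructure_anti _ hle)
  -- finiteness of the dual Selmer groups (they are bounded by `#H¹_𝓚`, which is finite)
  haveI hfin𝓚 : Finite 𝓚.selmerGroup := by
    have h := W.finite_selmerGroup_holds (n := ((p ^ m : ℕ) : ℤ)) (Nat.cast_ne_zero.mpr (NeZero.ne (p ^ m)))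
    rw [selmerGroup_eq_selmerGroup_kummerSelmerStructure] at h
    exact h
  haveI hfinD𝓚 : Finite D𝓚 := by
    rw [hD𝓚, dualSelmerGroup_eq_map_selmerGroup_dualTransported W (p ^ m) e hμ hadd₁ hadd₂ hgal hnondeg inv 𝓚,
      hsd]
    exact Finite.of_surjective _ (AddSubgroup.equivMapOfInjective 𝓚.selmerGroup _
      (map_weilDual_injective W (p ^ m) e hμ hadd₁ hadd₂ hgal hnondeg)).surjective
  haveI hfinD𝓖 : Finite D𝓖 := Finite.of_injective _ (AddSubgroup.inclusion_injective hDle)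
  -- `#B = #(w_* B) ∣ #H¹_{𝓖^*}`
  have hBcard : Nat.card B ∣ Nat.card D𝓖 := by
    rw [Nat.card_congr (AddSubgroup.equivMapOfInjective B _
      (map_weilDual_injective W (p ^ m) e hμ hadd₁ hadd₂ hgal hnondeg)).toEquiv]
    exact AddSubgroup.card_dvd_of_le hBmap
  -- Lagrange on the dual side: `[H¹_{𝓚^*} : H¹_{𝓖^*}] · #H¹_{𝓖^*} = #H¹_{𝓚^*}`
  have hlagD : D𝓖.relIndex D𝓚 * Nat.card D𝓖 = Nat.card D𝓚 := by
    have h1 : Nat.card (D𝓖.addSubgroupOf D𝓚) = Nat.card D𝓖 :=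
      Nat.card_congr (AddSubgroup.addSubgroupOfEquivOfLe hDle).toEquiv
    rw [AddSubgroup.relIndex, mul_comm, ← h1]
    exact AddSubgroup.card_mul_index _
  -- Lagrange: `[H¹_𝓖 : H¹_𝓚] · #H¹_𝓚 = #H¹_𝓖`
  have hlag : 𝓚.selmerGroup.relIndex 𝓖.selmerGroup * Nat.card 𝓚.selmerGroup = Nat.card 𝓖.selmerGroup := by
    have h1 : Nat.card (𝓚.selmerGroup.addSubgroupOf 𝓖.selmerGroup) = Nat.card 𝓚.selmerGroup :=
      Nat.card_congr (AddSubgroup.addSubgroupOfEquivOfLe (selmerGroup_mono hle)).toEquiv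
    rw [AddSubgroup.relIndex, mul_comm, ← h1]
    exact AddSubgroup.card_mul_index _
  -- assemble: `∏ · #B = a · (b · #B) ∣ a · (b · #D𝓖) = a · #D𝓚 ∣ a · #H¹_𝓚 = #H¹_𝓖`
  rw [← hprod, ← hlag, mul_assoc]
  refine mul_dvd_mul_left _ ?_
  calc D𝓖.relIndex D𝓚 * Nat.card B ∣ D𝓖.relIndex D𝓚 * Nat.card D𝓖 := mul_dvd_mul_left _ hBcard
    _ = Nat.card D𝓚 := hlagD
    _ ∣ Nat.card 𝓚.selmerGroup := hdualcard

end Brick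

/-! ## §3 The Kummer image of the rational points: size `≥ n^{rank}`, inside `Sel^{(n)}`, and
`T`-locally trivial when the rational points are `n`-divisible in `W(K_w)` -/

section KummerImage

variable {K : Type} [Field K] [NumberField K] (W : WeierstrassCurve K) [W.IsElliptic] {n : ℤ}

/-- **`#κ_n(W(K)) ≥ |n|^{rank W(K)}`** (`n = p^m`): the Kummer image of the rational points in
`H¹(K, W[n])` has at least `p^{m·rank}` elements — `ker κ_n = nW(K)` (tree `kummerMapTorsion_ker`),
Mordell–Weil (`module_finite_point_holds`) and §1; `κ_n(W(K)) ⊆ Sel^{(n)}(W/K)` is finite (tree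
`finite_selmerGroup_holds`). [cite: SilvermanAEC2009, VIII.§1–2 and Thm. X.4.2] -/
theorem pow_mul_mordellWeilRank_le_natCard_range_kummerMapTorsion (p m : ℕ) [hp : Fact p.Prime]
    (hdiv : ∀ P : geomPoints W, ∃ Q : geomPoints W, ((p ^ m : ℕ) : ℤ) • Q = P) :
    Finite (kummerMapTorsion W ((p ^ m : ℕ) : ℤ) hdiv).range ∧
      p ^ (m * W.mordellWeilRank) ≤ Nat.card (kummerMapTorsion W ((p ^ m : ℕ) : ℤ) hdiv).range := by
  have hn0 : ((p ^ m : ℕ) : ℤ) ≠ 0 := Nat.cast_ne_zero.mpr (pow_ne_zero m hp.out.ne_zero)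
  -- the Kummer image lies in the (finite) `n`-Selmer group
  have hle : (kummerMapTorsion W ((p ^ m : ℕ) : ℤ) hdiv).range ≤ selmerGroup W ((p ^ m : ℕ) : ℤ) := by
    rintro _ ⟨P, rfl⟩
    exact (mem_selmerGroup_iff W _ _).mpr
      ⟨fun v => kummerMapTorsion_mem_selmerLocalKer W _ hdiv _ P,
        fun w => kummerMapTorsion_mem_selmerLocalKer W _ hdiv _ P⟩
  haveI : Finite (selmerGroup W ((p ^ m : ℕ) : ℤ)) := W.finite_selmerGroup_holds hn0
  haveI hfin : Finite (kummerMapTorsion W ((p ^ m : ℕ) : ℤ) hdiv).range :=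
    Finite.of_injective _ (AddSubgroup.inclusion_injective hle)
  refine ⟨hfin, ?_⟩
  haveI : Module.Finite ℤ W.toAffine.Point := W.module_finite_point_holds
  have hker : ∀ a, kummerMapTorsion W ((p ^ m : ℕ) : ℤ) hdiv a = 0 → ∃ b, a = ((p ^ m : ℕ) : ℤ) • b := by
    intro a ha
    have ha' : a ∈ (kummerMapTorsion W ((p ^ m : ℕ) : ℤ) hdiv).ker := ha
    rw [kummerMapTorsion_ker] at ha'
    obtain ⟨b, hb⟩ := ha'
    exact ⟨b, hb.symm⟩
  have h := pow_finrank_le_natCard_range (kummerMapTorsion W ((p ^ m : ℕ) : ℤ) hdiv)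
    (pow_ne_zero m hp.out.ne_zero) (by exact_mod_cast hker)
  rwa [← pow_mul] at h

omit [W.IsElliptic] in
/-- **`κ_n(W(K)) ≤ H¹_𝓚(K, W[n]) = Sel^{(n)}(W/K)`**: the Kummer classes of rational points satisfy the
Kummer condition everywhere (tree `kummerMapTorsion_mem_selmerLocalKer`,
`selmerGroup_eq_selmerGroup_kummerSelmerStructure`). [cite: SilvermanAEC2009, X.§4 diagram (**)] -/
theorem range_kummerMapTorsion_le_selmerGroup_kummerSelmerStructure
    (hdiv : ∀ P : geomPoints W, ∃ Q : geomPoints W, n • Q = P) :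
    (kummerMapTorsion W n hdiv).range ≤
      (W.kummerSelmerStructure n : SelmerStructure (W.torsionGaloisModule n)).selmerGroup := by
  rintro _ ⟨P, rfl⟩
  rw [← selmerGroup_eq_selmerGroup_kummerSelmerStructure]
  exact (mem_selmerGroup_iff W _ _).mpr
    ⟨fun v => kummerMapTorsion_mem_selmerLocalKer W _ hdiv _ P,
      fun w => kummerMapTorsion_mem_selmerLocalKer W _ hdiv _ P⟩

/-- **`loc_w κ_n(P) = 0` when `P` is `n`-divisible in `W(K_w)`**: the localisation of the global Kummer
class of `P ∈ W(K)` at the finite place `w` is the local Kummer class of `P ∈ W(K_w)` (tree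
`res_kummerMapTorsion_eq_localKummerMap`), whose kernel is `nW(K_w)` (tree `ker_localKummerMap`).
[cite: SilvermanAEC2009, VIII.§2 and X.§4 diagram (**)] -/
theorem localization_kummerMapTorsion_eq_zero_of_divisible (hn : n ≠ 0)
    (hdiv : ∀ P : geomPoints W, ∃ Q : geomPoints W, n • Q = P) (w : HeightOneSpectrum (𝓞 K))
    (P : W.toAffine.Point)
    (hP : ∃ Q : (W.baseChange (Place.Completion (Sum.inr w : Place K))).toAffine.Point,
      n • Q = Affine.Point.baseChange (W' := W) K (Place.Completion (Sum.inr w : Place K)) P) :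
    galoisCohomology.localization (W.torsionGaloisModule n) (Sum.inr w) 1 (kummerMapTorsion W n hdiv P) = 0 := by
  obtain ⟨Q, hQ⟩ := hP
  haveI : CharZero (Place.Completion (Sum.inr w : Place K)) := charZero_adicCompletion w
  have hres := X11b.KummerIndex.res_kummerMapTorsion_eq_localKummerMap W
    (Place.Completion (Sum.inr w : Place K)) hn hdiv P
  have hmem : Affine.Point.baseChange (W' := W) K (Place.Completion (Sum.inr w : Place K)) P ∈
      (W.localKummerMap (Place.Completion (Sum.inr w : Place K)) hn).ker := by
    rw [W.ker_localKummerMap (Place.Completion (Sum.inr w : Place K)) hn]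
    exact AddMonoidHom.mem_range.mpr ⟨Q, (zsmulAddGroupHom_apply n Q).trans hQ⟩
  have h0 := (AddMonoidHom.mem_ker).mp hmem
  rw [← hres] at h0
  exact h0

end KummerImage

end TamagawaRoad

end Summit.BirchSwinnertonDyer.BirchSwinnertonDyer.Theorems

end
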